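import Summits.Ventures.HSemireg.WedgeHankelRecurrenceClasses

/-!
# Venture HSemireg — THE RECURRENCES OF EVERY CLASS BEYOND THE WINDOW FORM A COMPLETE INTERSECTION (uniform in the node at `∞`): for `R^N(q) = r ≥ 1`, `2r ≤ N + 1`, `m ≠ 0` spanning
# `Rec^N_r(q)` and ANY `g ∈ Rec^N_{N+2−r}(q)` which is not a multiple `h·m` with `deg h ≤ N + 2 − 2r` (such `g` exist), **`Rec^N_{N+2−r+j}(q) = m·K[X]_{≤ N+2−2r+j} ⊕ g·K[X]_{≤ j}`
# for every `j ≤ r − 1` (direct), `K[X]_{≤ N+1} = m·K[X]_{≤ N+1−r} ⊕ g·K[X]_{≤ r−1}`, hence `gcd(m, g) = 1`; and when the class is POLAR (`deg m < r`) every such `g` has full degree `N + 2 − r`**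

HONEST FRAMING. Part of the Lean index of the computation cell `pub-hsemireg` (seat p10 gen 29, Sunday typer «UNIFORM-IN-n»).
LINEAR ALGEBRA OF HANKEL (catalecticant) MATRICES and of polynomials over a field ONLY: no variety, no cohomology theory, no sheaf, no Ext group and no semiregularity map is constructed
here; nothing here says that HC / HC_CM / HC_AV holds; no Literature fact is declared or used.  Custodian versions as in `WedgeHankelSiegelIdeal` (1/3); the dictionary («apolar ideal of a
binary form of degree `N` with middle catalecticant rank `r` = a complete intersection of degrees `r`, `N + 2 − r`», Macaulay / Iarrobino–Kanev; «polar» = a node at `∞`, N34/N43) is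
QUOTED, never asserted — the statements below are about the spaces `Rec^N_k(q)` only.

WHAT IS IN THE TREE.  N41 (`WedgeHankelRecurrenceApolarCI`) proved this shape for AFFINE classes `q = dualSeq m a` (`deg m = r`) with the specific second generator `b = a⁻¹ mod m` of degree
`< r`; gen-27 OPEN (δ) asked for the classes WITH a node at `∞` («chart change only when `m(0) ≠ 0`»).  Here: NO chart change, every class, every field — the second generator is any element
of the first window beyond the range of `m` that is not accounted for by `m`, and the proof is a dimension count (N18's recurrence row) plus the exactness `Rec_k = {p : p, X·p ∈ Rec_{k+1}}`.
N18 (`WedgeHankelRecurrenceModule`, № 173): `recSpace`, `mem_recSpace_iff`, `hkFun_X_mul`, `recSpace_le_degreeLT`, `recSpace_le_succ`, `X_mul_mem_recSpace_succ`, `map_mulRight_degreeLT_le_recSpace`,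
`finrank_map_mulRight_degreeLT`, `finrank_recSpace_eq_sub_min`, `recSpace_eq_degreeLT_of_lt`, `finiteDimensional_recSpace`, `finrank_polynomial_degreeLT`, `mem_degreeLT_succ_iff`,
`natDegree_le_of_mem_recSpace` (and, inside the window, `recSpace_eq_map_mulRight`: `Rec_{r+d} = m·K[X]_{≤ d}` for `2r + d ≤ N + 1` — not restated); N29 (№ 237) `mem_recSpace_succ_succ_iff`
(level `N` ↔ level `N + 1`); N42 (№ 275) `rank_half_level_succ_le_add_one` (`R^{N+1} ≤ R^N + 1`); N43 (№ 323) `IsPolarClass`.  Mathlib: `Submodule.finrank_sup_add_finrank_inf_eq`,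
`Submodule.eq_of_le_of_finrank_eq`, `Submodule.finrank_mono`, `Submodule.finrank_eq_zero`, `Submodule.equivMapOfInjective`, `Submodule.map_sup`.
THIS FILE (namespace `Summit.Ventures.HSemireg.Wedge.HankelOuter` continued; PLAIN on tree files; 0 definitions).  Pieces: `A_j := (degreeLT K (N+2−r−r+j+1)).map (mulRight m)` = `m·K[X]_{≤ N+2−2r+j}`,
`B_j := (degreeLT K (j+1)).map (mulRight g)` = `g·K[X]_{≤ j}` (spelled out in every statement).
* §580 EXACTNESS: **`mem_recSpace_of_X_mul_mem`** (`k + 1 ≤ N`, `deg p ≤ k`, `p, X·p ∈ Rec_{k+1} ⇒ p ∈ Rec_k`), **`recSpace_succ_inf_map_mulLeft_X`** (`Rec_{k+1} ⊓ X·Rec_{k+1} = X·Rec_k`).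
* §581 BEYOND THE WINDOW: **`finrank_recSpace_beyond`** (`R = r`, `2r ≤ N+1`, `N+1 ≤ k + r`, `k ≤ N+1 ⇒ dim Rec_k = 2k − N`), **`recSpace_succ_eq_sup_map_mulLeft_X`** (`N+2 ≤ k + r`, `k ≤ N ⇒
  Rec_{k+1} = Rec_k + X·Rec_k`: beyond the window the module is generated by the first step).
* §582 THE COMPLETE INTERSECTION: **`exists_mem_recSpace_not_mem_map_mulRight`** (a second generator exists), **`recSpace_beyond_eq_sup_of_not_mem`** (`Rec_{N+2−r+j} = A_j ⊔ B_j`, `j + 1 ≤ r`),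
  **`map_mulRight_inf_map_mulRight_eq_bot_of_not_mem`** (`A_j ⊓ B_j = ⊥`), **`degreeLT_eq_sup_of_not_mem`** (`K[X]_{≤ N+1} = m·K[X]_{≤ N+1−r} ⊔ g·K[X]_{≤ r−1}`), **`isCoprime_of_not_mem`**
  (`gcd(m, g) = 1`), `exists_C_mul_add_mul_of_mem_recSpace_beyond` (the second generator is unique modulo `m·K[X]_{≤ N+2−2r}` up to a scalar).
* §583 POLAR CLASSES: **`finrank_recSpace_inf_degreeLT_beyond`** (`dim (Rec_{N+2−r} ⊓ K[X]_{≤ N+1−r}) = N + 3 − 2r` — one full-degree direction always), **`natDegree_eq_of_not_mem_of_natDegree_lt`**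
  (`deg m < r ⇒` every second generator has `deg g = N + 2 − r`), **`exists_second_generator_of_isPolarClass`** (gen-27 OPEN (δ): for a POLAR class of rank `r` with minimal recurrence `m`
  there is `g ∈ Rec_{N+2−r}` of full degree `N + 2 − r`, prime to `m`, with `Rec_{N+2−r+j} = m·K[X]_{≤ N+2−2r+j} ⊕ g·K[X]_{≤ j}` for all `j ≤ r − 1`).
Nothing Ext-side.  New names only.
-/

open Module Polynomial
open scoped Matrix Polynomial

namespace Summit.Ventures.HSemireg.Wedge.HankelOuter

open Summit.Ventures.HSemireg.Wedge Summit.Ventures.HSemireg.Wedge.Hankel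

variable (K : Type*) [Field K] {N : ℕ}

/-! ## §580. Exactness of consecutive windows -/

/-- **EXACTNESS: for `k + 1 ≤ N`, a polynomial `p` of degree `≤ k` with `p ∈ Rec_{k+1}(q)` and `X·p ∈ Rec_{k+1}(q)` lies in `Rec_k(q)`** (the equations of window `k + 1` are those of
window `k + 2` for `p` and for `X·p` together). -/
theorem mem_recSpace_of_X_mul_mem {q : ℕ → K} {k : ℕ} (hk : k + 1 ≤ N) {p : K[X]} (hdeg : p ∈ Polynomial.degreeLT K (k + 1)) (hp : p ∈ recSpace K N q (k + 1))
    (hXp : Polynomial.X * p ∈ recSpace K N q (k + 1)) : p ∈ recSpace K N q k := by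
  rw [mem_recSpace_iff] at hp hXp ⊢
  refine ⟨hdeg, fun s hs => ?_⟩
  rcases Nat.eq_zero_or_pos s with rfl | hs0
  · exact hp.2 0 (by omega)
  · have h := hXp.2 (s - 1) (by omega)
    rwa [hkFun_X_mul, show s - 1 + 1 = s by omega] at h

/-- **`Rec_{k+1}(q) ⊓ X·Rec_{k+1}(q) = X·Rec_k(q)`** for `k + 1 ≤ N` (N18 for `⊇`, exactness for `⊆`). -/
theorem recSpace_succ_inf_map_mulLeft_X {q : ℕ → K} {k : ℕ} (hk : k + 1 ≤ N) :
    recSpace K N q (k + 1) ⊓ (recSpace K N q (k + 1)).map (LinearMap.mulLeft K (Polynomial.X : K[X])) = (recSpace K N q k).map (LinearMap.mulLeft K (Polynomial.X : K[X])) := by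
  refine le_antisymm ?_ ?_
  · rintro x ⟨hx, ⟨p, hp, rfl⟩⟩
    change Polynomial.X * p ∈ recSpace K N q (k + 1) at hx
    refine ⟨p, mem_recSpace_of_X_mul_mem K hk ?_ hp hx, rfl⟩
    have hXp := (mem_degreeLT_succ_iff K).mp (recSpace_le_degreeLT K q (k + 1) hx)
    rw [mem_degreeLT_succ_iff]
    rcases eq_or_ne p 0 with rfl | hp0
    · rw [Polynomial.natDegree_zero]; exact Nat.zero_le _
    · rw [Polynomial.natDegree_X_mul hp0] at hXp; omega
  · rintro _ ⟨p, hp, rfl⟩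
    exact ⟨X_mul_mem_recSpace_succ K hp, ⟨p, recSpace_le_succ K q k hp, rfl⟩⟩

/-! ## §581. Beyond the window: dimensions and generation by the first step -/

/-- **THE RECURRENCE ROW BEYOND THE WINDOW: for `R^N(q) = r`, `2r ≤ N + 1`, `N + 1 ≤ k + r` and `k ≤ N + 1`, `dim Rec_k(q) = 2k − N`** (N18's row `k + 1 − min(k+1, N+1−k, r)` with the minimum
at `N + 1 − k`; `k = N + 1` is everything, `N + 2`). -/
theorem finrank_recSpace_beyond {r k : ℕ} {q : ℕ → K} (hq : (hankel1 K N (N / 2) q).rank = r) (h2 : r + r ≤ N + 1) (hk1 : N + 1 ≤ k + r) (hk2 : k ≤ N + 1) :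
    finrank K (recSpace K N q k) = 2 * k - N := by
  rcases Nat.lt_or_ge N k with hlt | hle
  · rw [recSpace_eq_degreeLT_of_lt K hlt, finrank_polynomial_degreeLT]; omega
  · rw [finrank_recSpace_eq_sub_min K hle q, hq, min_eq_right (show N + 1 - k ≤ k + 1 by omega), min_eq_left (show N + 1 - k ≤ r by omega)]
    omega

/-- **BEYOND THE WINDOW THE RECURRENCE MODULE IS GENERATED BY ITS FIRST STEP: `Rec_{k+1}(q) = Rec_k(q) + X·Rec_k(q)` for `R^N(q) = r`, `2r ≤ N + 1`, `N + 2 ≤ k + r`, `k ≤ N`** (dimension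
count: `2k − N + 2 = 2(2k − N) − (2k − N − 2)`, the intersection being `X·Rec_{k−1}` by §580). -/
theorem recSpace_succ_eq_sup_map_mulLeft_X {r k : ℕ} {q : ℕ → K} (hq : (hankel1 K N (N / 2) q).rank = r) (h2 : r + r ≤ N + 1) (hk1 : N + 2 ≤ k + r) (hk2 : k ≤ N) :
    recSpace K N q (k + 1) = recSpace K N q k ⊔ (recSpace K N q k).map (LinearMap.mulLeft K (Polynomial.X : K[X])) := by
  obtain ⟨k, rfl⟩ : ∃ k', k = k' + 1 := ⟨k - 1, by omega⟩
  haveI := finiteDimensional_recSpace K (N := N) q k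
  haveI := finiteDimensional_recSpace K (N := N) q (k + 1)
  haveI := finiteDimensional_recSpace K (N := N) q (k + 1 + 1)
  symm
  refine Submodule.eq_of_le_of_finrank_eq (sup_le (recSpace_le_succ K q (k + 1)) ?_) ?_
  · rintro _ ⟨p, hp, rfl⟩
    exact X_mul_mem_recSpace_succ K hp
  · have hsum := Submodule.finrank_sup_add_finrank_inf_eq (recSpace K N q (k + 1)) ((recSpace K N q (k + 1)).map (LinearMap.mulLeft K (Polynomial.X : K[X])))
    have hinjX : Function.Injective (LinearMap.mulLeft K (Polynomial.X : K[X])) := mul_right_injective₀ Polynomial.X_ne_zero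
    rw [recSpace_succ_inf_map_mulLeft_X K (show k + 1 ≤ N by omega), ← (Submodule.equivMapOfInjective _ hinjX (recSpace K N q (k + 1))).finrank_eq,
      ← (Submodule.equivMapOfInjective _ hinjX (recSpace K N q k)).finrank_eq, finrank_recSpace_beyond K hq h2 (k := k + 1) (by omega) (by omega),
      finrank_recSpace_beyond K hq h2 (k := k) (by omega) (by omega)] at hsum
    rw [finrank_recSpace_beyond K hq h2 (k := k + 1 + 1) (by omega) (by omega)]
    omega

/-! ## §582. The complete intersection beyond the window -/

section CI

variable {K}
variable {r : ℕ} {q : ℕ → K} {m g : K[X]}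

/-- the `m`-part grows with `j` and absorbs one shift. -/
theorem map_mulLeft_X_map_mulRight_degreeLT_le (m : K[X]) (n : ℕ) :
    ((Polynomial.degreeLT K (n + 1)).map (LinearMap.mulRight K m)).map (LinearMap.mulLeft K (Polynomial.X : K[X])) ≤ (Polynomial.degreeLT K (n + 1 + 1)).map (LinearMap.mulRight K m) := by
  rintro _ ⟨_, ⟨p, hp, rfl⟩, rfl⟩
  refine ⟨Polynomial.X * p, ?_, ?_⟩
  · rw [SetLike.mem_coe, mem_degreeLT_succ_iff] at hp ⊢
    exact (Polynomial.natDegree_mul_le).trans (by have := Polynomial.natDegree_X_le (R := K); omega)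
  · simp only [LinearMap.mulRight_apply, LinearMap.mulLeft_apply, mul_assoc]

/-- `m·K[X]_{≤ n} ≤ m·K[X]_{≤ n+1}`. -/
theorem map_mulRight_degreeLT_mono (m : K[X]) {n n' : ℕ} (h : n ≤ n') :
    (Polynomial.degreeLT K n).map (LinearMap.mulRight K m) ≤ (Polynomial.degreeLT K n').map (LinearMap.mulRight K m) :=
  Submodule.map_mono (Polynomial.degreeLT_mono h)

variable (K)

/-- **A SECOND GENERATOR EXISTS: for `R^N(q) = r ≥ 1`, `2r ≤ N + 1`, `0 ≠ m ∈ Rec_r(q)`, some `g ∈ Rec_{N+2−r}(q)` is not of the form `h·m`, `deg h ≤ N + 2 − 2r`** (`dim Rec_{N+2−r} = N + 4 − 2r`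
exceeds `dim m·K[X]_{≤ N+2−2r} = N + 3 − 2r`). -/
theorem exists_mem_recSpace_not_mem_map_mulRight (hq : (hankel1 K N (N / 2) q).rank = r) (hr : 1 ≤ r) (h2 : r + r ≤ N + 1) (hm0 : m ≠ 0) :
    ∃ g ∈ recSpace K N q (N + 2 - r), g ∉ (Polynomial.degreeLT K (N + 2 - r - r + 1)).map (LinearMap.mulRight K m) := by
  by_contra h
  have hle : recSpace K N q (N + 2 - r) ≤ (Polynomial.degreeLT K (N + 2 - r - r + 1)).map (LinearMap.mulRight K m) := fun g hg => by_contra fun hgA => h ⟨g, hg, hgA⟩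
  have h1 := Submodule.finrank_mono hle
  rw [finrank_map_mulRight_degreeLT K hm0, finrank_recSpace_beyond K hq h2 (by omega) (by omega)] at h1
  omega

/-- **THE COMPLETE INTERSECTION: `Rec_{N+2−r+j}(q) = m·K[X]_{≤ N+2−2r+j} + g·K[X]_{≤ j}` for every `j ≤ r − 1`**, for `R^N(q) = r`, `2r ≤ N + 1`, `0 ≠ m ∈ Rec_r(q)` and ANY `g ∈ Rec_{N+2−r}(q)` outside
`m·K[X]_{≤ N+2−2r}` (`j = 0`: the two pieces meet in `0` and have the right total dimension; `j → j + 1`: §581's `Rec_{k+1} = Rec_k + X·Rec_k` and both pieces absorb the shift). -/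
theorem recSpace_beyond_eq_sup_of_not_mem (hq : (hankel1 K N (N / 2) q).rank = r) (h2 : r + r ≤ N + 1) (hm : m ∈ recSpace K N q r) (hm0 : m ≠ 0)
    (hg : g ∈ recSpace K N q (N + 2 - r)) (hgA : g ∉ (Polynomial.degreeLT K (N + 2 - r - r + 1)).map (LinearMap.mulRight K m)) :
    ∀ {j : ℕ}, j + 1 ≤ r → recSpace K N q (N + 2 - r + j)
      = (Polynomial.degreeLT K (N + 2 - r - r + j + 1)).map (LinearMap.mulRight K m) ⊔ (Polynomial.degreeLT K (j + 1)).map (LinearMap.mulRight K g) := by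
  have hg0 : g ≠ 0 := by rintro rfl; exact hgA (Submodule.zero_mem _)
  -- the pieces lie in the recurrence spaces
  have hA : ∀ j, (Polynomial.degreeLT K (N + 2 - r - r + j + 1)).map (LinearMap.mulRight K m) ≤ recSpace K N q (N + 2 - r + j) := fun j => by
    have h := map_mulRight_degreeLT_le_recSpace K hm (N + 2 - r - r + j)
    rwa [show r + (N + 2 - r - r + j) = N + 2 - r + j by omega] at h
  have hB : ∀ j, (Polynomial.degreeLT K (j + 1)).map (LinearMap.mulRight K g) ≤ recSpace K N q (N + 2 - r + j) := fun j => map_mulRight_degreeLT_le_recSpace K hg j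
  intro j
  induction j with
  | zero =>
    intro hr
    haveI := finiteDimensional_recSpace K (N := N) q (N + 2 - r)
    rw [Nat.add_zero]
    refine (Submodule.eq_of_le_of_finrank_eq (sup_le (by have := hA 0; rwa [Nat.add_zero, Nat.add_zero] at this) (by have := hB 0; rwa [Nat.add_zero] at this)) ?_).symm
    -- the two pieces meet in `0`
    have hinf : (Polynomial.degreeLT K (N + 2 - r - r + 1)).map (LinearMap.mulRight K m) ⊓ (Polynomial.degreeLT K (0 + 1)).map (LinearMap.mulRight K g) = ⊥ := by
      rw [Submodule.eq_bot_iff]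
      rintro x ⟨hxA, ⟨ρ, hρ, rfl⟩⟩
      set c : K := ρ.coeff 0
      have hρC : ρ = Polynomial.C c := Polynomial.eq_C_of_natDegree_le_zero ((mem_degreeLT_succ_iff K).mp hρ)
      have hxA' : ρ * g ∈ (Polynomial.degreeLT K (N + 2 - r - r + 1)).map (LinearMap.mulRight K m) := hxA
      rcases eq_or_ne c 0 with hc | hc
      · rw [LinearMap.mulRight_apply, hρC, hc, Polynomial.C_0, zero_mul]
      · exfalso
        refine hgA ?_
        rw [hρC] at hxA'
        have hx := Submodule.smul_mem _ c⁻¹ hxA'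
        rw [← Polynomial.C_mul', ← mul_assoc, ← Polynomial.C_mul, inv_mul_cancel₀ hc, Polynomial.C_1, one_mul] at hx
        exact hx
    have hsum := Submodule.finrank_sup_add_finrank_inf_eq ((Polynomial.degreeLT K (N + 2 - r - r + 1)).map (LinearMap.mulRight K m)) ((Polynomial.degreeLT K (0 + 1)).map (LinearMap.mulRight K g))
    rw [hinf, finrank_bot, Nat.add_zero, finrank_map_mulRight_degreeLT K hm0, finrank_map_mulRight_degreeLT K hg0] at hsum
    rw [Nat.add_zero, hsum, finrank_recSpace_beyond K hq h2 (by omega) (by omega)]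
    omega
  | succ j ih =>
    intro hj
    have hstep := recSpace_succ_eq_sup_map_mulLeft_X K hq h2 (k := N + 2 - r + j) (by omega) (by omega)
    rw [show N + 2 - r + (j + 1) = N + 2 - r + j + 1 by omega, hstep, ih (by omega), Submodule.map_sup]
    refine le_antisymm (sup_le (sup_le_sup (map_mulRight_degreeLT_mono m (by omega)) (map_mulRight_degreeLT_mono g (by omega))) (sup_le_sup ?_ ?_)) ?_
    · have h := map_mulLeft_X_map_mulRight_degreeLT_le (K := K) m (N + 2 - r - r + j)
      rwa [show N + 2 - r - r + j + 1 + 1 = N + 2 - r - r + (j + 1) + 1 by omega] at h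
    · exact map_mulLeft_X_map_mulRight_degreeLT_le (K := K) g j
    · rw [← Submodule.map_sup, ← ih (by omega), ← hstep, ← show N + 2 - r + (j + 1) = N + 2 - r + j + 1 by omega]
      exact sup_le (hA (j + 1)) (hB (j + 1))

/-- **THE SUM IS DIRECT: `m·K[X]_{≤ N+2−2r+j} ⊓ g·K[X]_{≤ j} = 0` for `j ≤ r − 1`** (dimensions: `(N + 3 − 2r + j) + (j + 1) = 2(N + 2 − r + j) − N`). -/
theorem map_mulRight_inf_map_mulRight_eq_bot_of_not_mem (hq : (hankel1 K N (N / 2) q).rank = r) (h2 : r + r ≤ N + 1) (hm : m ∈ recSpace K N q r) (hm0 : m ≠ 0)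
    (hg : g ∈ recSpace K N q (N + 2 - r)) (hgA : g ∉ (Polynomial.degreeLT K (N + 2 - r - r + 1)).map (LinearMap.mulRight K m)) {j : ℕ} (hj : j + 1 ≤ r) :
    (Polynomial.degreeLT K (N + 2 - r - r + j + 1)).map (LinearMap.mulRight K m) ⊓ (Polynomial.degreeLT K (j + 1)).map (LinearMap.mulRight K g) = ⊥ := by
  have hg0 : g ≠ 0 := by rintro rfl; exact hgA (Submodule.zero_mem _)
  have hsum := Submodule.finrank_sup_add_finrank_inf_eq ((Polynomial.degreeLT K (N + 2 - r - r + j + 1)).map (LinearMap.mulRight K m)) ((Polynomial.degreeLT K (j + 1)).map (LinearMap.mulRight K g))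
  rw [← recSpace_beyond_eq_sup_of_not_mem K hq h2 hm hm0 hg hgA hj, finrank_map_mulRight_degreeLT K hm0, finrank_map_mulRight_degreeLT K hg0,
    finrank_recSpace_beyond K hq h2 (by omega) (by omega)] at hsum
  rw [← Submodule.finrank_eq_zero]
  omega

/-- **THE TOP DEGREE: `K[X]_{≤ N+1} = m·K[X]_{≤ N+1−r} + g·K[X]_{≤ r−1}`** (`j = r − 1`: `Rec_{N+1}(q)` is everything). -/
theorem degreeLT_eq_sup_of_not_mem (hq : (hankel1 K N (N / 2) q).rank = r) (hr : 1 ≤ r) (h2 : r + r ≤ N + 1) (hm : m ∈ recSpace K N q r) (hm0 : m ≠ 0)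
    (hg : g ∈ recSpace K N q (N + 2 - r)) (hgA : g ∉ (Polynomial.degreeLT K (N + 2 - r - r + 1)).map (LinearMap.mulRight K m)) :
    Polynomial.degreeLT K (N + 1 + 1) = (Polynomial.degreeLT K (N + 2 - r)).map (LinearMap.mulRight K m) ⊔ (Polynomial.degreeLT K r).map (LinearMap.mulRight K g) := by
  have h := recSpace_beyond_eq_sup_of_not_mem K hq h2 hm hm0 hg hgA (j := r - 1) (by omega)
  rw [show N + 2 - r + (r - 1) = N + 1 by omega, show N + 2 - r - r + (r - 1) + 1 = N + 2 - r by omega, show r - 1 + 1 = r by omega,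
    recSpace_eq_degreeLT_of_lt K (Nat.lt_succ_self N)] at h
  exact h

/-- **THE TWO GENERATORS ARE COPRIME: `IsCoprime m g`** (`1 ∈ K[X]_{≤ N+1} = m·K[X]_{≤ N+1−r} + g·K[X]_{≤ r−1}`). -/
theorem isCoprime_of_not_mem (hq : (hankel1 K N (N / 2) q).rank = r) (hr : 1 ≤ r) (h2 : r + r ≤ N + 1) (hm : m ∈ recSpace K N q r) (hm0 : m ≠ 0)
    (hg : g ∈ recSpace K N q (N + 2 - r)) (hgA : g ∉ (Polynomial.degreeLT K (N + 2 - r - r + 1)).map (LinearMap.mulRight K m)) : IsCoprime m g := by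
  have h1 : (1 : K[X]) ∈ Polynomial.degreeLT K (N + 1 + 1) := (mem_degreeLT_succ_iff K).mpr (by rw [Polynomial.natDegree_one]; exact Nat.zero_le _)
  rw [degreeLT_eq_sup_of_not_mem K hq hr h2 hm hm0 hg hgA, Submodule.mem_sup] at h1
  obtain ⟨_, ⟨u, -, rfl⟩, _, ⟨v, -, rfl⟩, huv⟩ := h1
  exact ⟨u, v, by simpa only [LinearMap.mulRight_apply] using huv⟩

/-- **THE SECOND GENERATOR IS UNIQUE MODULO `m` UP TO A SCALAR: every `g′ ∈ Rec_{N+2−r}(q)` is `c·g + h·m` with `deg h ≤ N + 2 − 2r`** (the case `j = 0`). -/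
theorem exists_C_mul_add_mul_of_mem_recSpace_beyond (hq : (hankel1 K N (N / 2) q).rank = r) (hr : 1 ≤ r) (h2 : r + r ≤ N + 1) (hm : m ∈ recSpace K N q r) (hm0 : m ≠ 0)
    (hg : g ∈ recSpace K N q (N + 2 - r)) (hgA : g ∉ (Polynomial.degreeLT K (N + 2 - r - r + 1)).map (LinearMap.mulRight K m)) {g' : K[X]} (hg' : g' ∈ recSpace K N q (N + 2 - r)) :
    ∃ (c : K) (h : K[X]), h ∈ Polynomial.degreeLT K (N + 2 - r - r + 1) ∧ g' = Polynomial.C c * g + h * m := by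
  have h0 := recSpace_beyond_eq_sup_of_not_mem K hq h2 hm hm0 hg hgA (j := 0) (by omega)
  rw [Nat.add_zero, Nat.add_zero] at h0
  rw [h0, Submodule.mem_sup] at hg'
  obtain ⟨_, ⟨h, hh, rfl⟩, _, ⟨ρ, hρ, rfl⟩, hsum⟩ := hg'
  have hρC : ρ = Polynomial.C (ρ.coeff 0) := Polynomial.eq_C_of_natDegree_le_zero ((mem_degreeLT_succ_iff K).mp hρ)
  exact ⟨ρ.coeff 0, h, hh, by rw [← hsum, LinearMap.mulRight_apply, LinearMap.mulRight_apply, ← hρC, add_comm]⟩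

end CI

/-! ## §583. Polar classes: the second generator has full degree -/

/-- **ONE FULL-DEGREE DIRECTION, ALWAYS: `dim (Rec_{N+2−r}(q) ⊓ K[X]_{≤ N+1−r}) = N + 3 − 2r = dim Rec_{N+2−r}(q) − 1`** for `R^N(q) = r ≥ 1`, `2r ≤ N + 1` (the intersection is
`Rec^{N−1}_{N+1−r}(q|_{[0,N−1]})` by N29, whose dimension N18 computes from `R^{N−1} ≥ R^N − 1`, N42). -/
theorem finrank_recSpace_inf_degreeLT_beyond {r : ℕ} {q : ℕ → K} (hq : (hankel1 K N (N / 2) q).rank = r) (hr : 1 ≤ r) (h2 : r + r ≤ N + 1) :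
    finrank K ↥(recSpace K N q (N + 2 - r) ⊓ Polynomial.degreeLT K (N + 2 - r)) = N + 3 - 2 * r := by
  obtain ⟨N, rfl⟩ : ∃ N', N = N' + 1 := ⟨N - 1, by omega⟩
  -- the intersection is the level-`N` recurrence space of window index `N + 2 − r`
  have hW : recSpace K (N + 1) q (N + 1 + 2 - r) ⊓ Polynomial.degreeLT K (N + 1 + 2 - r) = recSpace K N q (N + 2 - r) := by
    ext p
    rw [Submodule.mem_inf, show N + 1 + 2 - r = N + 2 - r + 1 by omega]
    constructor
    · rintro ⟨hp, hdeg⟩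
      exact (mem_recSpace_succ_succ_iff K hdeg).mp hp
    · intro hp
      have hdeg : p ∈ Polynomial.degreeLT K (N + 2 - r + 1) := recSpace_le_degreeLT K q _ hp
      exact ⟨(mem_recSpace_succ_succ_iff K hdeg).mpr hp, hdeg⟩
  rw [hW]
  have hR := rank_half_level_succ_le_add_one K (N := N) q
  rw [hq] at hR
  rcases Nat.lt_or_ge N (N + 2 - r) with hlt | hle
  · -- `r = 1`: everything
    rw [recSpace_eq_degreeLT_of_lt K hlt, finrank_polynomial_degreeLT]; omega
  · rw [finrank_recSpace_eq_sub_min K hle q, min_eq_right (show N + 1 - (N + 2 - r) ≤ N + 2 - r + 1 by omega),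
      min_eq_left (show N + 1 - (N + 2 - r) ≤ (hankel1 K N (N / 2) q).rank by omega)]
    omega

/-- **FOR A POLAR CLASS EVERY SECOND GENERATOR HAS FULL DEGREE: `R^N(q) = r`, `2r ≤ N + 1`, `0 ≠ m ∈ Rec_r(q)` with `deg m < r`, `g ∈ Rec_{N+2−r}(q) ∖ m·K[X]_{≤ N+2−2r} ⇒ deg g = N + 2 − r`**
(`m·K[X]_{≤ N+2−2r}` lies inside `Rec_{N+2−r} ⊓ K[X]_{≤ N+1−r}` when `deg m ≤ r − 1` and has its dimension `N + 3 − 2r`, so they are equal). -/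
theorem natDegree_eq_of_not_mem_of_natDegree_lt {r : ℕ} {q : ℕ → K} {m g : K[X]} (hq : (hankel1 K N (N / 2) q).rank = r) (h2 : r + r ≤ N + 1) (hm : m ∈ recSpace K N q r) (hm0 : m ≠ 0)
    (hmr : m.natDegree < r) (hg : g ∈ recSpace K N q (N + 2 - r)) (hgA : g ∉ (Polynomial.degreeLT K (N + 2 - r - r + 1)).map (LinearMap.mulRight K m)) : g.natDegree = N + 2 - r := by
  have hr : 1 ≤ r := by omega
  have hle : g.natDegree ≤ N + 2 - r := (mem_degreeLT_succ_iff K).mp (recSpace_le_degreeLT K q _ hg)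
  by_contra hne
  have hlt : g.natDegree ≤ N + 1 - r := by omega
  haveI := finiteDimensional_recSpace K (N := N) q (N + 2 - r)
  -- `A_0 ≤ W := Rec_{N+2−r} ⊓ K[X]_{≤ N+1−r}`, with equal dimensions
  have hAW : (Polynomial.degreeLT K (N + 2 - r - r + 1)).map (LinearMap.mulRight K m) ≤ recSpace K N q (N + 2 - r) ⊓ Polynomial.degreeLT K (N + 2 - r) := by
    refine le_inf ?_ ?_
    · have h := map_mulRight_degreeLT_le_recSpace K hm (N + 2 - r - r)
      rwa [show r + (N + 2 - r - r) = N + 2 - r by omega] at h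
    · rintro _ ⟨p, hp, rfl⟩
      rw [SetLike.mem_coe, mem_degreeLT_succ_iff] at hp
      rw [LinearMap.mulRight_apply, show N + 2 - r = N + 1 - r + 1 by omega, mem_degreeLT_succ_iff]
      exact (Polynomial.natDegree_mul_le).trans (by omega)
  have hEq : (Polynomial.degreeLT K (N + 2 - r - r + 1)).map (LinearMap.mulRight K m) = recSpace K N q (N + 2 - r) ⊓ Polynomial.degreeLT K (N + 2 - r) := by
    refine Submodule.eq_of_le_of_finrank_eq hAW ?_
    rw [finrank_map_mulRight_degreeLT K hm0, finrank_recSpace_inf_degreeLT_beyond K hq hr h2]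
    omega
  refine hgA ?_
  rw [hEq, Submodule.mem_inf, show N + 2 - r = N + 1 - r + 1 by omega, mem_degreeLT_succ_iff]
  exact ⟨by rw [show N + 1 - r + 1 = N + 2 - r by omega]; exact hg, hlt⟩

/-- **GEN-27 OPEN (δ) — THE APOLAR COMPLETE INTERSECTION OF A CLASS WITH A NODE AT `∞`: for a POLAR class `q` of rank `r` on `[0, N]` (`2r ≤ N + 1`) with minimal recurrence `m` (monic,
`m ∈ Rec_r(q)`; then `deg m < r`) there is `g ∈ Rec_{N+2−r}(q)` of FULL degree `N + 2 − r`, prime to `m`, with `Rec_{N+2−r+j}(q) = m·K[X]_{≤ N+2−2r+j} ⊕ g·K[X]_{≤ j}` (direct) for every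
`j ≤ r − 1`** — no chart change, every field. -/
theorem exists_second_generator_of_isPolarClass {r : ℕ} {q : ℕ → K} {m : K[X]} (hP : IsPolarClass K N r q) (h2 : r + r ≤ N + 1) (hm : m ∈ recSpace K N q r) (hm0 : m ≠ 0) :
    ∃ g : K[X], g ∈ recSpace K N q (N + 2 - r) ∧ g.natDegree = N + 2 - r ∧ IsCoprime m g ∧
      (∀ j, j + 1 ≤ r → recSpace K N q (N + 2 - r + j)
          = (Polynomial.degreeLT K (N + 2 - r - r + j + 1)).map (LinearMap.mulRight K m) ⊔ (Polynomial.degreeLT K (j + 1)).map (LinearMap.mulRight K g)) ∧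
      (∀ j, j + 1 ≤ r → (Polynomial.degreeLT K (N + 2 - r - r + j + 1)).map (LinearMap.mulRight K m) ⊓ (Polynomial.degreeLT K (j + 1)).map (LinearMap.mulRight K g) = ⊥) := by
  have hmr : m.natDegree < r := hP.2 m hm hm0
  have hr : 1 ≤ r := by omega
  obtain ⟨g, hg, hgA⟩ := exists_mem_recSpace_not_mem_map_mulRight K (m := m) hP.rank_eq hr h2 hm0
  exact ⟨g, hg, natDegree_eq_of_not_mem_of_natDegree_lt K hP.rank_eq h2 hm hm0 hmr hg hgA, isCoprime_of_not_mem K hP.rank_eq hr h2 hm hm0 hg hgA,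
    fun j hj => recSpace_beyond_eq_sup_of_not_mem K hP.rank_eq h2 hm hm0 hg hgA hj,
    fun j hj => map_mulRight_inf_map_mulRight_eq_bot_of_not_mem K hP.rank_eq h2 hm hm0 hg hgA hj⟩

end Summit.Ventures.HSemireg.Wedge.HankelOuter
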